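import Mathlib
import HarnessLib
import Summits.Ventures.LatticeQCDFlow.Scaling.AutoregressiveGaugeRedundancyWilson
import Summits.Ventures.LatticeQCDFlow.Scaling.Wilson2DU1PlaquetteDensity

/-!
# LatticeQCDFlow / Scaling — two dimensions, `U(1)`: THE LINK CLOSING A PLAQUETTE READS ITS STAPLE
# (the exact autoregressive conditional of the closing link is not a function of the link alone)

HONEST FRAMING: exact (Metropolis-corrected) sampling algorithms for lattice gauge theory;
figures of merit are autocorrelation/cost numbers at stated couplings and volumes; no
continuum-physics claim.

Venture `LatticeQCDFlow` (cell pub-lqcd), topic `Scaling`, FANOUT row 30 (lean-1, GEN-17) — OUR WORK on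
THEORY-2.md §4 row C5, gauge case, POSITIVE direction.  GEN-15 (`Scaling/AutoregressiveGaugePlaquetteClass`)
showed that with everything but a plaquette's four links `e₁,…,e₄` integrated (`s = {e₁,…,e₄}ᶜ`) the
exact conditional `A_s F / A_{insert e₁ s} F` of the closing link `e₁` given its STAPLE `(e₂,e₃,e₄)` is
a class function of link × staple, and left open whether it is non-constant.  Here, for `G = U(1)`,
`d = 2`, the Wilson weight `F = e^{−β S_W}`, every `L ≥ 2` and every `β > 0`:

* §1 bookkeeping: bounds `e^{−2βL²} ≤ A_t F ≤ 1` for every `t` (`coordAvg_wilson_bounds`); the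
  geometry of the plaquette `(x; 0, 1)` (its links and corners are distinct, `L ≥ 2`).
* §2 **`wilson2D_u1_closingLink_reads_staple`** — there are two configurations agreeing off the three
  staple links on which the exact conditional of `U_{e₁}` differs: THE CLOSING LINK READS ITS STAPLE.
  Proof (no harmonic analysis, no normal form): if the conditional `R = N/M` (`N = A_s F`,
  `M = A_{insert e₁ s} F`) did not read the staple it would be a function `r(U_{e₁})` of the link
  alone; the corner rotation at `x + e₀` (GEN-15 I `coordAvg_pathHolonomy`:
  `N(U₁g⁻¹, gU₂, …) = N(U)`) then forces `r(ab)·r(1) = r(a)·r(b)` — `r/r(1)` is a bounded positive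
  multiplicative character of the compact group, hence trivial, so `N` would not read `e₁` at all;
  redrawing `e₁` (`LatticeSiteResampling`) and `A_s F` = conditional expectation (GEN-15 II
  `integral_mul_coordAvg_eq`) would make the law of the plaquette holonomy Haar — contradicting the
  strictly peaked continuous density of `Scaling/Wilson2DU1PlaquetteDensity` /
  `Scaling/U1ConvolutionPowerPeak`.

READING (value-free, C5): for two-dimensional `U(1)` the exact autoregressive context of the link
closing a plaquette is NOT empty — the holonomy class of GEN-15 is genuinely read — at every `β > 0`
and every volume `L ≥ 2`.  NOT CLAIMED: non-abelian groups, `d ≥ 3` (expected; the strictness needs the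
character expansion); which function of the staple is read beyond "not constant"; any number of ours.
Elementary over the parents; no `def`; nothing is cited as a fact; no `sorry`.
-/

noncomputable section

namespace Summit.Ventures.LatticeQCDFlow.Theory2.Autoregressive

open MeasureTheory Function Set
open Literature.MathematicalPhysics.QuantumFieldTheory Literature.MathematicalPhysics.QuantumLattice
open Summit.Ventures.LatticeQCDFlow.Exactness Summit.Ventures.LatticeQCDFlow.Theory2.HaarConv
open scoped ENNReal

variable {L : ℕ} [NeZero L]

/-! ## §1 Bookkeeping: bounds on the marginals; geometry of the plaquette `(x; 0, 1)` -/

/-- Coordinate averages of a weight squeezed between two constants are squeezed between them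
(probability reference measure; bounded measurable weight). [ours] -/
theorem coordAvg_mem_Icc {ι : Type*} [Fintype ι] [DecidableEq ι] {X : Type*} [MeasurableSpace X]
    (μ : Measure X) [IsProbabilityMeasure μ] (s : Finset ι) {G : (ι → X) → ℝ} (hG : Measurable G)
    {lo hi : ℝ} (hlo : ∀ ω, lo ≤ G ω) (hhi : ∀ ω, G ω ≤ hi) (ω : ι → X) :
    lo ≤ coordAvg μ s G ω ∧ coordAvg μ s G ω ≤ hi := by
  have hm : Measurable fun ω' : ι → X => G (s.piecewise ω' ω) :=
    hG.comp ((Exactness.measurable_piecewise_prod s).comp (measurable_const.prodMk measurable_id))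
  have hint : Integrable (fun ω' : ι → X => G (s.piecewise ω' ω)) (Measure.pi fun _ : ι => μ) := by
    refine Integrable.mono' (integrable_const (max |lo| |hi|)) hm.aestronglyMeasurable
      (ae_of_all _ fun ω' => ?_)
    rw [Real.norm_eq_abs, abs_le]
    constructor
    · exact le_trans (by have := neg_abs_le lo; have := le_max_left |lo| |hi|; linarith) (hlo _)
    · exact le_trans (hhi _) ((le_abs_self hi).trans (le_max_right _ _))
  unfold coordAvg
  constructor
  · calc lo = ∫ _, lo ∂Measure.pi (fun _ : ι => μ) := by simp
      _ ≤ _ := integral_mono (integrable_const lo) hint fun ω' => hlo _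
  · calc (∫ ω', G (s.piecewise ω' ω) ∂Measure.pi (fun _ : ι => μ))
        ≤ ∫ _, hi ∂Measure.pi (fun _ : ι => μ) := integral_mono hint (integrable_const hi) fun ω' => hhi _
      _ = hi := by simp

omit [NeZero L] in
/-- Geometry of the plaquette `(x; 0, 1)` on `(ℤ/L)²`, `L ≥ 2`: the corner `x + e₀` differs from the
corners `x`, `x + e₁`, `x + e₀ + e₁`. [ours] -/
theorem plaq_corner_facts (hL : 2 ≤ L) (x : Site 2 L) :
    x ≠ x.shift 0 ∧ x.shift 1 ≠ x.shift 0 ∧ (x.shift 0).shift 1 ≠ x.shift 0 ∧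
      (x.shift 1).shift 0 ≠ x.shift 0 := by
  haveI : Fact (1 < L) := ⟨hL⟩
  have hcomm : (x.shift 1).shift 0 = (x.shift 0).shift 1 := by
    simp only [Site.shift]
    exact add_right_comm _ _ _
  refine ⟨(site_shift_ne hL x 0).symm, fun h => ?_, site_shift_ne hL (x.shift 0) 1,
    hcomm ▸ site_shift_ne hL (x.shift 0) 1⟩
  have h1 := congrFun h 1
  simp [Site.shift] at h1

/-! ## §2 The closing link reads its staple -/

/-- **THE LINK CLOSING A PLAQUETTE READS ITS STAPLE** (2-d `U(1)`, Wilson action, every `L ≥ 2`,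
`β > 0`).  With `s` the links off the plaquette `(x; 0, 1)`, `e₁ = (x, 0)` the closing link and
`e₂ = (x+e₀, 1)`, `e₃ = (x+e₁, 0)`, `e₄ = (x, 1)` its staple, `N = A_s e^{−βS_W}`,
`M = A_{insert e₁ s} e^{−βS_W}`: there are two configurations agreeing off `{e₂, e₃, e₄}` on which the
exact conditional `N/M` of `U_{e₁}` differs. [ours] -/
theorem wilson2D_u1_closingLink_reads_staple (hL : 2 ≤ L) {β : ℝ} (hβ : 0 < β) (x : Site 2 L) :
    ∃ U U' : GaugeConfig 2 L Circle,
      (∀ e : Edge 2 L, e ≠ (x.shift 0, (1 : Fin 2)) → e ≠ (x.shift 1, (0 : Fin 2)) →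
        e ≠ (x, (1 : Fin 2)) → U e = U' e) ∧
      coordAvg (haarProbability Circle)
          (Finset.univ \ {(x, (0 : Fin 2)), (x.shift 0, (1 : Fin 2)), (x.shift 1, (0 : Fin 2)), (x, (1 : Fin 2))})
          (fun V : GaugeConfig 2 L Circle => Real.exp (-β * wilsonAction u1Rep V)) U /
        coordAvg (haarProbability Circle)
          (insert (x, (0 : Fin 2))
            (Finset.univ \ {(x, (0 : Fin 2)), (x.shift 0, (1 : Fin 2)), (x.shift 1, (0 : Fin 2)), (x, (1 : Fin 2))}))
          (fun V : GaugeConfig 2 L Circle => Real.exp (-β * wilsonAction u1Rep V)) U ≠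
      coordAvg (haarProbability Circle)
          (Finset.univ \ {(x, (0 : Fin 2)), (x.shift 0, (1 : Fin 2)), (x.shift 1, (0 : Fin 2)), (x, (1 : Fin 2))})
          (fun V : GaugeConfig 2 L Circle => Real.exp (-β * wilsonAction u1Rep V)) U' /
        coordAvg (haarProbability Circle)
          (insert (x, (0 : Fin 2))
            (Finset.univ \ {(x, (0 : Fin 2)), (x.shift 0, (1 : Fin 2)), (x.shift 1, (0 : Fin 2)), (x, (1 : Fin 2))}))
          (fun V : GaugeConfig 2 L Circle => Real.exp (-β * wilsonAction u1Rep V)) U' := by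
  classical
  -- names
  set μ := haarProbability Circle with hμ
  set e₁ : Edge 2 L := (x, (0 : Fin 2)) with he₁
  set e₂ : Edge 2 L := (x.shift 0, (1 : Fin 2)) with he₂
  set e₃ : Edge 2 L := (x.shift 1, (0 : Fin 2)) with he₃
  set e₄ : Edge 2 L := (x, (1 : Fin 2)) with he₄
  set s : Finset (Edge 2 L) := Finset.univ \ {e₁, e₂, e₃, e₄} with hs
  set F : GaugeConfig 2 L Circle → ℝ := fun V => Real.exp (-β * wilsonAction u1Rep V) with hF
  set N := coordAvg μ s F with hN
  set M := coordAvg μ (insert e₁ s) F with hM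
  by_contra hcon
  push Not at hcon
  -- hcon : ∀ U U', (agree off the staple) → N U / M U = N U' / M U'
  obtain ⟨hx0, hx10, hx01, hx10'⟩ := plaq_corner_facts hL x
  have h01 : (0 : Fin 2) ≠ 1 := by decide
  have n12 : e₁ ≠ e₂ := fun h => h01 (congrArg Prod.snd h)
  have n13 : e₁ ≠ e₃ := fun h => (site_shift_ne hL x 1) (congrArg Prod.fst h).symm
  have n14 : e₁ ≠ e₄ := fun h => h01 (congrArg Prod.snd h)
  have hmem_s : ∀ e : Edge 2 L, e ∈ s ↔ e ≠ e₁ ∧ e ≠ e₂ ∧ e ≠ e₃ ∧ e ≠ e₄ := by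
    intro e; simp [hs]
  have he₁s : e₁ ∉ s := by simp [hs]
  -- weight facts
  obtain ⟨hFm, hFb, hFlo⟩ := wilsonWeight_two_u1_props (L := L) β hβ.le
  have hFgi : IsGaugeInvariant F := isGaugeInvariant_wilsonWeightFun u1Rep β
  set ε : ℝ := Real.exp (-(2 * β * (L : ℝ) ^ 2)) with hε
  have hε0 : 0 < ε := Real.exp_pos _
  have hF1 : ∀ V, F V ≤ 1 := fun V => (le_abs_self _).trans (hFb V)
  have hNb : ∀ U, ε ≤ N U ∧ N U ≤ 1 := fun U => coordAvg_mem_Icc μ s hFm hFlo hF1 U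
  have hMb : ∀ U, ε ≤ M U ∧ M U ≤ 1 := fun U => coordAvg_mem_Icc μ (insert e₁ s) hFm hFlo hF1 U
  have hNpos : ∀ U, 0 < N U := fun U => lt_of_lt_of_le hε0 (hNb U).1
  have hMpos : ∀ U, 0 < M U := fun U => lt_of_lt_of_le hε0 (hMb U).1
  -- what `N` and `M` read
  have hNoff : ∀ U U' : GaugeConfig 2 L Circle, (∀ e, e ∉ s → U e = U' e) → N U = N U' :=
    fun U U' h => coordAvg_congr_off s F h
  have hMoff : ∀ U U' : GaugeConfig 2 L Circle, (∀ e, e ∉ insert e₁ s → U e = U' e) → M U = M U' :=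
    fun U U' h => coordAvg_congr_off (insert e₁ s) F h
  have hMe₁ : ∀ (U : GaugeConfig 2 L Circle) (v : Circle), M (update U e₁ v) = M U := by
    intro U v
    refine hMoff _ _ fun e he => ?_
    have : e ≠ e₁ := fun h => he (h ▸ Finset.mem_insert_self e₁ s)
    exact update_of_ne this _ _
  -- Step 2: under `hcon`, the conditional is a function of `U_{e₁}` alone
  let cfg : Circle → GaugeConfig 2 L Circle := fun c => update 1 e₁ c
  let r : Circle → ℝ := fun c => N (cfg c) / M (cfg c)
  have hR : ∀ U : GaugeConfig 2 L Circle, N U / M U = r (U e₁) := by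
    intro U
    -- `Ũ = s.piecewise 1 U` has the same `N`, `M` and agrees with `cfg (U e₁)` off the staple
    have hNt : N (s.piecewise 1 U) = N U := coordAvg_apply_piecewise μ s F U 1
    have hMt : M (s.piecewise 1 U) = M U := by
      refine hMoff _ _ fun e he => ?_
      have hes : e ∉ s := fun h => he (Finset.mem_insert_of_mem h)
      exact Finset.piecewise_eq_of_notMem _ _ _ hes
    rw [← hNt, ← hMt]
    refine hcon _ _ fun e h2 h3 h4 => ?_
    by_cases h1 : e = e₁
    · subst h1; simp [cfg, Finset.piecewise_eq_of_notMem _ _ _ he₁s]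
    · have hes : e ∈ s := (hmem_s e).2 ⟨h1, h2, h3, h4⟩
      simp [cfg, Finset.piecewise_eq_of_mem _ _ _ hes, update_of_ne h1]
  have hrpos : ∀ c, 0 < r c := fun c => div_pos (hNpos _) (hMpos _)
  have hrle : ∀ c, r c ≤ 1 / ε := fun c => div_le_div₀ zero_le_one (hNb _).2 hε0 (hMb _).1
  -- Step 3: `N = r(U_{e₁}) · M`
  have hNM : ∀ U : GaugeConfig 2 L Circle, N U = r (U e₁) * M U := by
    intro U
    have h := hR U
    rw [div_eq_iff (hMpos U).ne'] at h
    exact h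
  -- Step 4: the corner rotation at `x + e₀` (GEN-15 I): `N(U₁g⁻¹, gU₂, …) = N(U)`
  have hmove : ∀ (U : GaugeConfig 2 L Circle) (g : Circle),
      N (update (update U e₁ (U e₁ * g⁻¹)) e₂ (g * U e₂)) = N U := by
    intro U g
    refine coordAvg_pathHolonomy (s := s) hFgi (y := x.shift 0) (ℓ₁ := e₁) (ℓ₂ := e₂) n12 rfl hx0
      rfl hx01 (fun e he h1 h2 => (hmem_s e).2 ⟨h1, h2, ?_, ?_⟩) U g
    · rintro rfl
      rcases he with h | h
      · exact hx10 h
      · exact hx10' h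
    · rintro rfl
      rcases he with h | h
      · exact hx0 h
      · exact hx10 h
  -- Step 5: the functional equation for `r`
  have hstar2 : ∀ (U : GaugeConfig 2 L Circle) (g : Circle),
      r (U e₁ * g⁻¹) * M (update U e₂ (g * U e₂)) = r (U e₁) * M U := by
    intro U g
    have h1 := hNM (update (update U e₁ (U e₁ * g⁻¹)) e₂ (g * U e₂))
    rw [hmove U g, hNM U] at h1
    have he : (update (update U e₁ (U e₁ * g⁻¹)) e₂ (g * U e₂)) e₁ = U e₁ * g⁻¹ := by
      rw [update_of_ne n12, update_self]
    have hMM : M (update (update U e₁ (U e₁ * g⁻¹)) e₂ (g * U e₂)) = M (update U e₂ (g * U e₂)) := by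
      rw [update_comm n12]
      exact hMe₁ _ _
    rw [he, hMM] at h1
    exact h1.symm
  have hstar3 : ∀ (U : GaugeConfig 2 L Circle) (g : Circle),
      r g⁻¹ * M (update U e₂ (g * U e₂)) = r 1 * M U := by
    intro U g
    have h := hstar2 (update U e₁ 1) g
    rw [update_self, one_mul, hMe₁, update_of_ne n12.symm, update_comm n12, hMe₁] at h
    exact h
  -- Step 6: `r/r(1)` is a bounded multiplicative character of `U(1)`, hence trivial
  have hchar : ∀ a b : Circle, r (a * b) * r 1 = r a * r b := by
    intro a b
    have h2 := hstar2 (cfg a) b⁻¹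
    have h3 := hstar3 (cfg a) b⁻¹
    have hca : cfg a e₁ = a := update_self _ _ _
    simp only [inv_inv, hca] at h2 h3
    set M' := M (update (cfg a) e₂ (b⁻¹ * cfg a e₂))
    have e1 : r (a * b) * r b * M' = r b * (r a * M (cfg a)) := by
      rw [← h2]; ring
    have e2 : r (a * b) * r b * M' = r (a * b) * (r 1 * M (cfg a)) := by
      rw [← h3]; ring
    have key : (r (a * b) * r 1) * M (cfg a) = (r a * r b) * M (cfg a) := by linarith
    exact mul_right_cancel₀ (hMpos _).ne' key
  have hq_mul : ∀ a b : Circle, r (a * b) / r 1 = (r a / r 1) * (r b / r 1) := by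
    intro a b
    have h1 : r 1 ≠ 0 := (hrpos 1).ne'
    field_simp
    linarith [hchar a b]
  have hq_pow : ∀ (a : Circle) (n : ℕ), r (a ^ n) / r 1 = (r a / r 1) ^ n := by
    intro a n
    induction n with
    | zero => simp [div_self (hrpos 1).ne']
    | succ n ih => rw [pow_succ, hq_mul, ih, pow_succ]
  have hq_bdd : ∀ a : Circle, r a / r 1 ≤ (1 / ε) / r 1 := fun a =>
    div_le_div_of_nonneg_right (hrle a) (hrpos 1).le
  have hq_le_one : ∀ a : Circle, r a / r 1 ≤ 1 := by
    intro a
    by_contra h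
    push Not at h
    obtain ⟨n, hn⟩ := pow_unbounded_of_one_lt ((1 / ε) / r 1) h
    have := hq_bdd (a ^ n)
    rw [hq_pow] at this
    linarith
  have hr_const : ∀ a : Circle, r a = r 1 := by
    intro a
    have h1 := hq_le_one a
    have h2 := hq_le_one a⁻¹
    have hm := hq_mul a a⁻¹
    rw [mul_inv_cancel, div_self (hrpos 1).ne'] at hm
    have qpos : 0 < r a / r 1 := div_pos (hrpos a) (hrpos 1)
    have qpos' : 0 < r a⁻¹ / r 1 := div_pos (hrpos _) (hrpos 1)
    have hq1 : r a / r 1 = 1 := by nlinarith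
    rwa [div_eq_one_iff_eq (hrpos 1).ne'] at hq1
  -- Step 7: hence `N` does not read the closing link at all
  have hNe₁ : ∀ (U : GaugeConfig 2 L Circle) (v : Circle), N (update U e₁ v) = N U := by
    intro U v
    rw [hNM, hNM U, update_self, hr_const, hr_const (U e₁), hMe₁]
  -- Step 8: then the plaquette holonomy would be Haar-distributed under the Wilson weight
  have hD := wilson2D_u1_density_not_ae_const β hβ (L ^ 2 - 2)
    (∫ V, F V ∂Measure.pi (fun _ : Edge 2 L => μ))
  apply hD
  -- the density is bounded measurable
  have hwm : Measurable (u1W β) := measurable_u1W β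
  have hKle : ∀ g, u1W β g * (haarConv (u1W β))^[L ^ 2 - 2] (u1W β) g ≤ 1 := fun g =>
    mul_le_one' (u1W_le_one hβ.le g) (iterate_apply_le_one hwm (u1W_le_one hβ.le) _ g)
  have hDm : Measurable fun g => (u1W β g * (haarConv (u1W β))^[L ^ 2 - 2] (u1W β) g).toReal :=
    (hwm.mul (measurable_iterate hwm hwm _)).ennreal_toReal
  have hDi : Integrable (fun g => (u1W β g * (haarConv (u1W β))^[L ^ 2 - 2] (u1W β) g).toReal) μ :=
    Integrable.mono' (integrable_const 1) hDm.aestronglyMeasurable (ae_of_all _ fun g => by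
      rw [Real.norm_eq_abs, abs_of_nonneg ENNReal.toReal_nonneg]
      exact ENNReal.toReal_le_of_le_ofReal zero_le_one (by simpa using hKle g))
  refine Integrable.ae_eq_of_forall_setIntegral_eq _ _ hDi (integrable_const _) fun A hA _ => ?_
  rw [setIntegral_const, ← wilson2D_u1_setIntegral_holonomy_eq β hL hβ.le x hA]
  show ∫ U, A.indicator (fun _ => (1 : ℝ)) (plaquetteHolonomy U x 0 1) * F U
      ∂(Measure.pi fun _ : Edge 2 L => μ) = _
  -- the test function `1_A ∘ hol` is blind to `s`
  let φ : Circle → ℝ := A.indicator fun _ => 1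
  have hφm : Measurable φ := measurable_const.indicator hA
  have hφb : ∀ g, |φ g| ≤ 1 := fun g => by
    simp only [φ, Set.indicator_apply]; split_ifs <;> simp
  have hn1 : ((x, (0 : Fin 2)) : Edge 2 L) ∉ s := he₁s
  have hn2 : ((x.shift 0, (1 : Fin 2)) : Edge 2 L) ∉ s := fun h => ((hmem_s _).1 h).2.1 rfl
  have hn3 : ((x.shift 1, (0 : Fin 2)) : Edge 2 L) ∉ s := fun h => ((hmem_s _).1 h).2.2.1 rfl
  have hn4 : ((x, (1 : Fin 2)) : Edge 2 L) ∉ s := fun h => ((hmem_s _).1 h).2.2.2 rfl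
  have hhol_s : ∀ U V : GaugeConfig 2 L Circle,
      plaquetteHolonomy (s.piecewise V U) x 0 1 = plaquetteHolonomy U x 0 1 := by
    intro U V
    simp only [plaquetteHolonomy, Finset.piecewise_eq_of_notMem _ _ _ hn1,
      Finset.piecewise_eq_of_notMem _ _ _ hn2, Finset.piecewise_eq_of_notMem _ _ _ hn3,
      Finset.piecewise_eq_of_notMem _ _ _ hn4]
  -- `∫ φ(hol)·F = ∫ φ(hol)·N` (conditional expectation)
  have hFm' : Measurable F := hFm
  have hFb' : ∃ C, ∀ U, |F U| ≤ C := ⟨1, hFb⟩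
  show ∫ U, φ (plaquetteHolonomy U x 0 1) * F U ∂(Measure.pi fun _ : Edge 2 L => μ) = _
  rw [integral_mul_coordAvg_eq μ s (Φ := fun U => φ (plaquetteHolonomy U x 0 1)) hFm' hFb'
    (hφm.comp (measurable_plaquetteHolonomy x 0 1)) ⟨1, fun U => hφb _⟩
    (fun U V => by simp only [hhol_s])]
  -- redraw `e₁`: `∫ φ(hol U)·N U = (∫ φ dμ)·(∫ N)`
  have huniv : (fun _ : Edge 2 L => μ) e₁ Set.univ ≠ 0 := by simp
  have hHm : Measurable fun U : GaugeConfig 2 L Circle => φ (plaquetteHolonomy U x 0 1) * N U :=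
    (hφm.comp (measurable_plaquetteHolonomy x 0 1)).mul (measurable_coordAvg μ s hFm)
  have hHi : Integrable (fun U : GaugeConfig 2 L Circle => φ (plaquetteHolonomy U x 0 1) * N U)
      (Measure.pi fun _ : Edge 2 L => μ) :=
    Integrable.mono' (integrable_const (1 * 1)) hHm.aestronglyMeasurable (ae_of_all _ fun U => by
      rw [Real.norm_eq_abs, abs_mul, abs_of_pos (hNpos U)]
      exact mul_le_mul (hφb _) (hNb U).2 (hNpos U).le zero_le_one)
  have hstep : ∫ U, φ (plaquetteHolonomy U x 0 1) * N U ∂Measure.pi (fun _ : Edge 2 L => μ) =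
      (∫ g, φ g ∂μ) * ∫ U, N U ∂Measure.pi (fun _ : Edge 2 L => μ) := by
    rw [integral_pi_eq_integral_integral_update' (fun _ : Edge 2 L => μ) e₁ huniv hHi]
    simp only [measure_univ, inv_one, ENNReal.toReal_one, one_smul]
    have hinner : ∀ U : GaugeConfig 2 L Circle,
        ∫ v, φ (plaquetteHolonomy (update U e₁ v) x 0 1) * N (update U e₁ v) ∂μ =
          (∫ g, φ g ∂μ) * N U := by
      intro U
      have hup : ∀ v : Circle, plaquetteHolonomy (update U e₁ v) x 0 1 =
          v * (U e₂ * (U e₃)⁻¹ * (U e₄)⁻¹) := fun v => plaquetteHolonomy_update_first hL U x h01 v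
      simp only [hNe₁, hup]
      rw [integral_mul_const]
      congr 1
      exact integral_mul_right_eq_self φ _
    simp_rw [hinner]
    exact integral_const_mul _ _
  rw [hstep, integral_coordAvg_eq μ s hFm ⟨1, hFb⟩]
  -- `∫ φ dμ = μ.real A`
  have hφint : ∫ g, φ g ∂μ = μ.real A := by
    simp only [φ]
    rw [integral_indicator hA, setIntegral_const, smul_eq_mul, mul_one]
  rw [hφint, smul_eq_mul]

end Summit.Ventures.LatticeQCDFlow.Theory2.Autoregressive

end
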